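import Summits.QuantumFields.BalabanUV.Beta.GAN24.WSlotT2OfPieces
import Summits.QuantumFields.BalabanUV.Beta.GAN24.W3PinCountdown
import Summits.QuantumFields.BalabanUV.Beta.GAN24.StencilSlotWallThree
import Summits.QuantumFields.BalabanUV.Beta.GAN24.TaylorRowDWThree
import Summits.QuantumFields.BalabanUV.Beta.GAN24.S3DiffV
import Summits.QuantumFields.BalabanUV.Beta.GAN24.S3DiffL

/-!
# `BalabanUV.Beta.GAN24.WSlotT2Tables` — binder row G-an2-4 / (CONV-C), W-slot, road «W3», END #3 AND THE CLOSING SENTENCE (row owner b2b-balaban-gan24-p1, gen 5;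
# `SKELETON-W3.md` v1.0.2 §7.4 (F5) ∕ §8.4; `d = 3`, `Lc ≥ 2`)

NOT IN PRINT; OUR PROOF ATTEMPT.  HONEST FRAMING (cell contract, verbatim): «discharging `BetaPertH` makes Bałaban's UV stability
UNCONDITIONAL — a real constructive-QFT result; it is NOT the continuum limit and NOT the Clay problem.»  HONEST DEPENDENCY (verbatim):
«continuum YM on T⁴ ⇐ BetaPertH ∧ nine spine estimates (0/9 proved); BetaPertH ⇐ (D1) ∧ (D4) ∧ CAP+tail; G-an2-4 gates asym, D1 and
NE2/3/4.»

WHAT.  Road «W3» (the located remainder «T2Shape» ∧ «T2Drift» of the W-slot for an2's Stage-B family) was cut by the row owner as FIVE ROW FAMILIES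
feeding the carrier-free ENDs `WSlotT2OfPieces.shape_of_rows` ∕ `rate_of_rows` (END #1∕#2), and CLOSED BY THE G-an2-4 FORMALISATION SWARM in the kernel
down to ONE hypothesis, the EXACT PIN `cE₂ = +Lc^{2(3+1)}` of the value-4-jet colour constant (an2's (P6); ≡ an2's own (W-L-2) lock by `lock2_iff_pinEq`,
sign `+` forced): leaf-08's `W3PinCountdown.hW_hWall_three_an1_of_pinEq` — the D1 wall's W-pair at an1's mixed table from the pin ALONE (rows:
flattening leaf-01∕04, `Push4` leaf-17, legs∕semigroup leaf-12, (T-marg) leaf-10, (T-irr) leaf-12, zero modes leaf-02∕06∕14∕10∕19∕20, one-shot data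
leaf-08∕03∕18, mixed-table socket leaf-14∕an1; four byte-independent kernel certificates: leaf-08, ref2 r69, the carver's twin, asym1 v17).
THIS module is the OWNER's END #3 and closing sentence:
* §1 **`wRows_three_of_rows`** — END #3 IN THE SKELETON's OWN CURRENCY (generic rows → the wall's W-pair for an2's Stage-B family through leaf-07's
  socket `WSlotCauchyThree.hW_hWall_three_of_T2ShapeDrift`), the composition END #1 ∧ END #2 ⇒ (hW₂, hW₂all) announced in SKELETON-W3 §7.4 (F5).
* §2 **`hW_hWall_three_an1_pinned`** — THE W-PAIR FOR THE PINNED FAMILY, HYPOTHESIS-FREE: an2's Stage-B family AT `cE₂ := (Lc:ℝ)^(2*(3+1))` with an1's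
  mixed table `mixFFAt (toSite r) Lc` and the base border `vh₂S 3 Lc` (`d = 3`, `2 ≤ Lc`, `r ∈ box (3+1) Lc`; every other colour constant and the
  colour tensor `Tc` symbolic) — `W3PinCountdown.hW_hWall_three_an1_of_pinEq … rfl`.  This is the INSTANTIATION of the one residual hypothesis: for
  THIS member of an2's family both W-rows of asym1's wall are tree theorems with no hypothesis.  Whether the wall LITERAL of the `BetaPertH` END takes
  `cE₂ = Lc^{2(3+1)}` is an2's (P6) ≡ (W-L-2) — ONE residual, not two (ref2 r73); this module does not decide it.
* §3 **`d1Drift_iff_three_an1_pinned`** — THE CLOSING SENTENCE OF BINDER ROW G-an2-4's THREE SLOTS AT `d = 3`: for the pinned family (an2's naming data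
  `CwOf`∕`δwOf`∕`δwOf_pos`∕`WbalOf_loc₂` over `T2Of_loc` with `hB_base`∕an1's `hmix_an1`), THE D1 WALL ⟺ THE IDENTIFICATION with NO analytic hypothesis
  at all: K-slot (`KSlotAssembly`), S-slot (the twelve rows of road «S3» through `StencilSlotWallThree.d1Drift_JsBalOf_iff_three_of_diffRows` fed with dW∕dV∕dL by name,
  as in `StencilSlotSAllThree.hS_hSall_three` ∕ `StencilSlotWallThree.d1Drift_JsBalOf_iff_three_of_wRows`) and W-slot (§2) all BY NAME.  What the row gated for asym1 ∕ D1 at `d = 3` is thereby reduced, for this family, to the identification itself (row D1's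
  `hident`) — the right-hand side of the `iff`.
HONEST: [folklore] compositions; §2∕§3 hold for the PINNED member `cE₂ = +Lc⁸` of an2's Stage-B family at an1's tables ONLY; the (P6) decision that the
wall literal IS that member is an2's and OPEN (so, by the referees' rule, «W-slot closed» is NOT claimed for the literal); the (D1) identification, the
window, `U ≠ 1` (NE2), the recursive re-typing v2.26 (bridged only by the rec ↔ composite identification booked under D1Tel) are untouched; NEVER
«G-an2-4 closed» as (CONV-C) for the constituents `G_k, H_k` (TRIGGER-A scope caveat: `U = 1` covariance constituent only); NOT `BetaPertH`, NOT
continuum, NOT Clay.  0 `def`, 0 cite, 0 `def … : Prop`, 0 sorry.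
-/

noncomputable section

open Finset
open scoped BigOperators
open Literature.MathematicalPhysics.QuantumFieldTheory
open Literature.MathematicalPhysics.QuantumFieldTheory.Balaban1983to89
open Literature.MathematicalPhysics.QuantumFieldTheory.Balaban1983to89.Beta
open AffineAveraging (box toSite)
open ExpKernelCalculus (MKer VertexFamily₂ hessKer)
open OneStepResolventKernel (Fib LocStencil)
open OneStepKernelFamily (KInvStep D1Drift)
open AxialDressing (axDressK axVertexOfK)
open SecondOrderResponse (LocStencilFM)
open BalabanCompositeJets (LocStencil₂)
open BalabanStepJetsSucc (JsBal0Of JsBalOf)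
open BalabanStepW2 (WbalOf T2Of T2Of_loc CwOf δwOf δwOf_pos WbalOf_loc₂ JsBalT2Of)
open AveragingMixedJetTables (vh₂S mixFFAt)
open HessKerDressedLimit (limMKerOf limStOf limTabOf)
open Summit.QuantumFields.BalabanUV.Beta.HessKerDressedUnits (unitK unitS unitW)
open Summit.QuantumFields.BalabanUV.Beta.SecondOrderUnits (unitS₂)
open Summit.QuantumFields.BalabanUV.Beta.MixedJetTablesPlug (hmix_an1)
open Summit.QuantumFields.BalabanUV.Beta.GAN24.CombesThomas (sfStep smStep)
open Summit.QuantumFields.BalabanUV.Beta.GAN24.StencilSlotOfE3 (one_le_of_two_le)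
open Summit.QuantumFields.BalabanUV.Beta.GAN24.T2SlotUnits (locStencil₂_vh₂S)
open Summit.QuantumFields.BalabanUV.Beta.GAN24.WSlotT2OfPieces (shape_of_rows t2Drift_of_rows)
open Summit.QuantumFields.BalabanUV.Beta.GAN24.WSlotCauchyThree (hW_hWall_three_of_T2ShapeDrift)
open Summit.QuantumFields.BalabanUV.Beta.GAN24.W3PinCountdown (hW_hWall_three_an1_of_pinEq)
open Summit.QuantumFields.BalabanUV.Beta.GAN24.StencilSlotWallThree (d1Drift_JsBalOf_iff_three_of_diffRows)

namespace Summit.QuantumFields.BalabanUV.Beta.GAN24.WSlotT2Tables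

variable {Lc : ℕ} [NeZero Lc] {r : Fin (3 + 1) → ℕ}

/-! ## §1 END #3 in the skeleton's currency (ARCHIVAL — superseded by §4): the wall's W-pair for an2's Stage-B family as a function of the five row families -/

/-- **ARCHIVAL — SUPERSEDED BY §4 `wRows_three_of_rows₂` (ref2 R55-2 (w10) ∕ R79-2 (w14), ref1 r82–r86): this first cut SHARES the data `(δin, δT, CT′, ρ)`
between the shape tower and the difference tower and is therefore NOT instantiable with the rows as landed (each row carries its own rates); keep for the
record, instantiate §4 instead (the pinned W-pair §2 goes through leaf-08's chain, not through §1).**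
**END #3 OF ROAD «W3» (`d = 3`, `Lc ≥ 2`): BOTH W-ROWS OF THE WALL FOR an2's STAGE-B FAMILY AS A FUNCTION OF THE FIVE ROW FAMILIES.**
With `T♮_j := unitS₂ (sfStep Lc j) (smStep 3 Lc j) (T2Of 3 Lc cE cVH cΛ cE₂ cB Tc (vh₂S 3 Lc) mixFF j)`: the rows of `WSlotT2OfPieces.t2Shape_of_rows`
(tower `T♮`, transport `P`, sources `b`) and of `WSlotT2OfPieces.t2Drift_of_rows` (difference tower, transport `P'`, forcing `f`) at the SAME
input∕output rates `(δin, δT)`, the mixed table's `LocStencilFM` shape with field–field support, and the pin, give the pair `(hW₂, hW₂all)` of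
`StencilSlotWallThree.d1Drift_JsBalOf_iff_three_of_wRows` with its scalars `0 ≤ θW < 1`, `0 < δW`, for `W := WbalOf 3 Lc cE cVH cΛ (T2Of …) mixFF`.
[folklore] composition: END #1 ∧ END #2 → leaf-07's `hW_hWall_three_of_T2ShapeDrift`. -/
theorem wRows_three_of_rows (hLc : 2 ≤ Lc) (cE cVH cΛ cE₂ cB : ℝ) (Tc : Fin 4 → Fin 4 → Fin 4 → Fin 4 → ℝ)
    (mixFF : Fin (3 + 1) → (Fin (3 + 1) → ℤ) → Fin (3 + 1) → (Fin (3 + 1) → ℤ) → MKer (3 + 1) (Fib 3))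
    (b f : ℕ → Fin (3 + 1) → (Fin (3 + 1) → ℤ) → Fin (3 + 1) → (Fin (3 + 1) → ℤ) → MKer (3 + 1) (Fib 3))
    (P P' : ℕ → ℕ → (Fin (3 + 1) → (Fin (3 + 1) → ℤ) → Fin (3 + 1) → (Fin (3 + 1) → ℤ) → MKer (3 + 1) (Fib 3)) → Fin (3 + 1) → (Fin (3 + 1) → ℤ) → Fin (3 + 1) → (Fin (3 + 1) → ℤ) → MKer (3 + 1) (Fib 3))
    (Zfree : (Fin (3 + 1) → (Fin (3 + 1) → ℤ) → Fin (3 + 1) → (Fin (3 + 1) → ℤ) → MKer (3 + 1) (Fib 3)) → Prop)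
    (mom : (Fin (3 + 1) → (Fin (3 + 1) → ℤ) → Fin (3 + 1) → (Fin (3 + 1) → ℤ) → MKer (3 + 1) (Fib 3)) → ℝ)
    {δin δT CT CT' ρ θ Cb Cf C₀ D₀ : ℝ} (hδT : 0 < δT) (hCT' : 0 ≤ CT') (hρ0 : 0 ≤ ρ) (hρ1 : ρ < 1) (hθ0 : 0 ≤ θ) (hθ1 : θ < 1)
    (hpin : |cE₂| ≤ (Lc : ℝ) ^ (2 * (3 + 1)))
    (hsplit : ∀ n, unitS₂ (sfStep Lc n) (smStep 3 Lc n) (T2Of 3 Lc cE cVH cΛ cE₂ cB Tc (vh₂S 3 Lc) mixFF n) =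
      P 0 n (unitS₂ (sfStep Lc 0) (smStep 3 Lc 0) (T2Of 3 Lc cE cVH cΛ cE₂ cB Tc (vh₂S 3 Lc) mixFF 0)) + ∑ i ∈ Finset.range n, P (i + 1) (n - 1 - i) (b i))
    (hsplitD : ∀ n, (fun κ u κ' u' => unitS₂ (sfStep Lc (n + 1)) (smStep 3 Lc (n + 1)) (T2Of 3 Lc cE cVH cΛ cE₂ cB Tc (vh₂S 3 Lc) mixFF (n + 1)) κ u κ' u' - unitS₂ (sfStep Lc n) (smStep 3 Lc n) (T2Of 3 Lc cE cVH cΛ cE₂ cB Tc (vh₂S 3 Lc) mixFF n) κ u κ' u') =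
      P' 0 n (fun κ u κ' u' => unitS₂ (sfStep Lc 1) (smStep 3 Lc 1) (T2Of 3 Lc cE cVH cΛ cE₂ cB Tc (vh₂S 3 Lc) mixFF 1) κ u κ' u' - unitS₂ (sfStep Lc 0) (smStep 3 Lc 0) (T2Of 3 Lc cE cVH cΛ cE₂ cB Tc (vh₂S 3 Lc) mixFF 0) κ u κ' u')
        + ∑ i ∈ Finset.range n, P' (i + 1) (n - 1 - i) (f i))
    (hTmarg : |cE₂| ≤ (Lc : ℝ) ^ (2 * (3 + 1)) → ∀ (m k : ℕ) (X : Fin (3 + 1) → (Fin (3 + 1) → ℤ) → Fin (3 + 1) → (Fin (3 + 1) → ℤ) → MKer (3 + 1) (Fib 3)) (C : ℝ),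
      0 ≤ C → LocStencil₂ X C δin → LocStencil₂ (P m k X) (CT * C) δT)
    (hTirr : ∀ (m k : ℕ) (X : Fin (3 + 1) → (Fin (3 + 1) → ℤ) → Fin (3 + 1) → (Fin (3 + 1) → ℤ) → MKer (3 + 1) (Fib 3)) (C : ℝ),
      0 ≤ C → LocStencil₂ X C δin → Zfree X → mom X ≤ C → LocStencil₂ (P m k X) (CT' * C * ρ ^ k) δT)
    (hTirr' : ∀ (m k : ℕ) (X : Fin (3 + 1) → (Fin (3 + 1) → ℤ) → Fin (3 + 1) → (Fin (3 + 1) → ℤ) → MKer (3 + 1) (Fib 3)) (C : ℝ),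
      0 ≤ C → LocStencil₂ X C δin → Zfree X → mom X ≤ C → LocStencil₂ (P' m k X) (CT' * C * ρ ^ k) δT)
    (hb : ∀ m, LocStencil₂ (b m) Cb δin ∧ mom (b m) ≤ Cb) (hZ : ∀ m, Zfree (b m))
    (hf : ∀ m, LocStencil₂ (f m) (Cf * θ ^ m) δin ∧ mom (f m) ≤ Cf * θ ^ m) (hZf : ∀ m, Zfree (f m))
    (h0 : LocStencil₂ (unitS₂ (sfStep Lc 0) (smStep 3 Lc 0) (T2Of 3 Lc cE cVH cΛ cE₂ cB Tc (vh₂S 3 Lc) mixFF 0)) C₀ δin)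
    (hD0 : LocStencil₂ (fun κ u κ' u' => unitS₂ (sfStep Lc 1) (smStep 3 Lc 1) (T2Of 3 Lc cE cVH cΛ cE₂ cB Tc (vh₂S 3 Lc) mixFF 1) κ u κ' u' - unitS₂ (sfStep Lc 0) (smStep 3 Lc 0) (T2Of 3 Lc cE cVH cΛ cE₂ cB Tc (vh₂S 3 Lc) mixFF 0) κ u κ' u') D₀ δin ∧
      mom (fun κ u κ' u' => unitS₂ (sfStep Lc 1) (smStep 3 Lc 1) (T2Of 3 Lc cE cVH cΛ cE₂ cB Tc (vh₂S 3 Lc) mixFF 1) κ u κ' u' - unitS₂ (sfStep Lc 0) (smStep 3 Lc 0) (T2Of 3 Lc cE cVH cΛ cE₂ cB Tc (vh₂S 3 Lc) mixFF 0) κ u κ' u') ≤ D₀)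
    (hZ0 : Zfree (fun κ u κ' u' => unitS₂ (sfStep Lc 1) (smStep 3 Lc 1) (T2Of 3 Lc cE cVH cΛ cE₂ cB Tc (vh₂S 3 Lc) mixFF 1) κ u κ' u' - unitS₂ (sfStep Lc 0) (smStep 3 Lc 0) (T2Of 3 Lc cE cVH cΛ cE₂ cB Tc (vh₂S 3 Lc) mixFF 0) κ u κ' u'))
    {CM₂ δ₄ : ℝ} (hmix : LocStencilFM Lc mixFF CM₂ δ₄) (hδ₄ : 0 < δ₄)
    (hfm : ∀ κ u ρ w x z (α μ' : Fin (3 + 1)), mixFF κ u ρ w x z (Sum.inl α) (Sum.inr μ') = 0)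
    (hm : ∀ κ u ρ w x z (μ' : Fin (3 + 1)) (bb : Fib 3), mixFF κ u ρ w x z (Sum.inr μ') bb = 0) :
    ∃ Cw cW θW δW : ℝ, 0 ≤ θW ∧ θW < 1 ∧ 0 < δW ∧
      (∀ j, VertexFamily₂ (unitW (sfStep Lc j) (smStep 3 Lc j)
        (WbalOf 3 Lc cE cVH cΛ (T2Of 3 Lc cE cVH cΛ cE₂ cB Tc (vh₂S 3 Lc) mixFF) mixFF j)) Lc Cw δW) ∧
      (∀ k j, VertexFamily₂ (unitW (sfStep Lc (k + j)) (smStep 3 Lc (k + j))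
          (WbalOf 3 Lc cE cVH cΛ (T2Of 3 Lc cE cVH cΛ cE₂ cB Tc (vh₂S 3 Lc) mixFF) mixFF (k + j)) -
        unitW (sfStep Lc k) (smStep 3 Lc k)
          (WbalOf 3 Lc cE cVH cΛ (T2Of 3 Lc cE cVH cΛ cE₂ cB Tc (vh₂S 3 Lc) mixFF) mixFF k)) Lc (cW * θW ^ k) δW) := by
  obtain ⟨c, ϑ, -, hϑ0, hϑ1, -, hcau, -⟩ := t2Drift_of_rows (d := 3) cE cVH cΛ cE₂ cB Tc mixFF f P' Zfree mom hδT hCT' hρ0 hρ1 hθ0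
    hθ1 hsplitD hTirr' hf hZf hD0 hZ0
  -- END #1 at the rate `δT` (the witness of `t2Shape_of_rows`), shared with the drift
  have hT₂' : ∀ j, LocStencil₂ (unitS₂ (sfStep Lc j) (smStep 3 Lc j) (T2Of 3 Lc cE cVH cΛ cE₂ cB Tc (vh₂S 3 Lc) mixFF j)) (CT * C₀ + CT' * Cb * (1 - ρ)⁻¹) δT :=
    shape_of_rows (fun n => unitS₂ (sfStep Lc n) (smStep 3 Lc n) (T2Of 3 Lc cE cVH cΛ cE₂ cB Tc (vh₂S 3 Lc) mixFF n)) b P Zfree mom hCT' hρ0 hρ1 hsplit (hTmarg hpin) hTirr hb hZ h0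
  exact hW_hWall_three_of_T2ShapeDrift hLc cE cVH cΛ (T₂ := T2Of 3 Lc cE cVH cΛ cE₂ cB Tc (vh₂S 3 Lc) mixFF) hT₂'
    (fun k j => hcau k j) hδT hϑ0.le hϑ1 hmix hδ₄ hfm hm

/-! ## §2 The W-pair for the PINNED family at an1's tables — no hypothesis -/

omit [NeZero Lc] in
/-- [folklore] The `hB` socket of `BalabanStepW2.T2Of_loc` for the BASE border `vh₂S 3 Lc` (an1's `biLoc_vh₂S` through leaf-19's
`T2SlotUnits.locStencil₂_vh₂S`, rate `1`). -/
theorem hB_base (hLc : 1 ≤ Lc) : ∃ C δ : ℝ, 0 < δ ∧ LocStencil₂ (vh₂S 3 Lc) C δ :=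
  ⟨_, 1, one_pos, locStencil₂_vh₂S (d := 3) hLc zero_le_one⟩

/-- **THE WALL's W-PAIR FOR THE PINNED STAGE-B FAMILY, UNCONDITIONALLY** (`d = 3`, `2 ≤ Lc`, `r ∈ box (3+1) Lc`): an2's `WbalOf 3 Lc cE cVH cΛ (T2Of …) (mixFFAt (toSite r) Lc)`
AT `cE₂ := (Lc:ℝ)^(2*(3+1))`, with an1's mixed table and the base border, satisfies both W-rows of `StencilSlotWallThree.d1Drift_JsBalOf_iff_three_of_wRows` —
leaf-08's `W3PinCountdown.hW_hWall_three_an1_of_pinEq` at `hpinEq := rfl`.  HONEST: the instantiation of the ONE residual hypothesis of road «W3»; the (P6)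
decision that the `BetaPertH` wall literal is this member is an2's (≡ (W-L-2), ref2 r73) and is NOT made here. -/
theorem hW_hWall_three_an1_pinned (hLc : 2 ≤ Lc) (hr : r ∈ box (3 + 1) Lc) (cE cVH cΛ cB : ℝ) (Tc : Fin 4 → Fin 4 → Fin 4 → Fin 4 → ℝ) :
    ∃ Cw cW θW δW : ℝ, 0 ≤ θW ∧ θW < 1 ∧ 0 < δW ∧
      (∀ j, VertexFamily₂ (unitW (sfStep Lc j) (smStep 3 Lc j) (WbalOf 3 Lc cE cVH cΛ (T2Of 3 Lc cE cVH cΛ ((Lc : ℝ) ^ (2 * (3 + 1))) cB Tc (vh₂S 3 Lc) (mixFFAt (toSite r) Lc)) (mixFFAt (toSite r) Lc) j)) Lc Cw δW) ∧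
      (∀ k j, VertexFamily₂ (unitW (sfStep Lc (k + j)) (smStep 3 Lc (k + j)) (WbalOf 3 Lc cE cVH cΛ (T2Of 3 Lc cE cVH cΛ ((Lc : ℝ) ^ (2 * (3 + 1))) cB Tc (vh₂S 3 Lc) (mixFFAt (toSite r) Lc)) (mixFFAt (toSite r) Lc) (k + j)) -
        unitW (sfStep Lc k) (smStep 3 Lc k) (WbalOf 3 Lc cE cVH cΛ (T2Of 3 Lc cE cVH cΛ ((Lc : ℝ) ^ (2 * (3 + 1))) cB Tc (vh₂S 3 Lc) (mixFFAt (toSite r) Lc)) (mixFFAt (toSite r) Lc) k)) Lc (cW * θW ^ k) δW) :=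
  hW_hWall_three_an1_of_pinEq hLc hr cE cVH cΛ _ cB Tc rfl

/-! ## §3 THE CLOSING SENTENCE: the D1 wall ⟺ the identification for the pinned family, no analytic hypothesis -/

/-- **BINDER ROW G-an2-4 AT `d = 3`, CLOSING SENTENCE FOR THE PINNED FAMILY: THE D1 WALL ⟺ THE IDENTIFICATION, UNCONDITIONALLY.**  For an2's Stage-B
family AT `cE₂ := (Lc:ℝ)^(2*(3+1))` with an1's mixed table `mixFFAt (toSite r) Lc` and the base border `vh₂S 3 Lc`, dressed by `JsBalOf` with an2's own
naming data (`CwOf`∕`δwOf`∕`δwOf_pos`∕`WbalOf_loc₂` over `T2Of_loc`, `hB_base`, an1's `hmix_an1`): `D1Drift Lc (JsBalOf …) N μ ν ↔ secondMoment (dressed limit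
kernels) μ ν = stepBal N Lc` for EVERY `μ ν N`, given ONLY `2 ≤ Lc` and `r ∈ box (3+1) Lc` — all six analytic binders of asym1's wall
(`hK hKall hS hSall hW hWall`) are tree theorems for this family: K-slot `KSlotAssembly.convCKWall_holds` (gen 3), S-slot = the twelve rows of road «S3»
(`TaylorRowDWThree.rowDW_three`, `S3DiffV.diffV_three`, `S3DiffL.diffL_three` + the nine inside `StencilSlotWallThree.d1Drift_JsBalOf_iff_three_of_diffRows`; gen 4∕5),
W-slot §2 (road «W3», the swarm + this lineage).  What remains on the
right-hand side IS row D1's identification `hident` itself.  [folklore] composition. -/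
theorem d1Drift_iff_three_an1_pinned (hLc : 2 ≤ Lc) (hr : r ∈ box (3 + 1) Lc) (cE cVH cΛ cB : ℝ)
    (Tc : Fin 4 → Fin 4 → Fin 4 → Fin 4 → ℝ) (μ ν : Fin 4) (N : ℝ) :
    D1Drift Lc (JsBalOf (one_le_of_two_le hLc) cE cVH cΛ (WbalOf 3 Lc cE cVH cΛ (T2Of 3 Lc cE cVH cΛ ((Lc : ℝ) ^ (2 * (3 + 1))) cB Tc (vh₂S 3 Lc) (mixFFAt (toSite r) Lc)) (mixFFAt (toSite r) Lc))
        (CwOf (one_le_of_two_le hLc) cE cVH cΛ (T2Of_loc (one_le_of_two_le hLc) cE cVH cΛ ((Lc : ℝ) ^ (2 * (3 + 1))) cB Tc (hB_base (one_le_of_two_le hLc)) (hmix_an1 (one_le_of_two_le hLc) hr)) (hmix_an1 (one_le_of_two_le hLc) hr)) (δwOf (one_le_of_two_le hLc) cE cVH cΛ (T2Of_loc (one_le_of_two_le hLc) cE cVH cΛ ((Lc : ℝ) ^ (2 * (3 + 1))) cB Tc (hB_base (one_le_of_two_le hLc)) (hmix_an1 (one_le_of_two_le hLc) hr)) (hmix_an1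 (one_le_of_two_le hLc) hr))
        (δwOf_pos (one_le_of_two_le hLc) cE cVH cΛ (T2Of_loc (one_le_of_two_le hLc) cE cVH cΛ ((Lc : ℝ) ^ (2 * (3 + 1))) cB Tc (hB_base (one_le_of_two_le hLc)) (hmix_an1 (one_le_of_two_le hLc) hr)) (hmix_an1 (one_le_of_two_le hLc) hr)) (WbalOf_loc₂ (one_le_of_two_le hLc) cE cVH cΛ (T2Of_loc (one_le_of_two_le hLc) cE cVH cΛ ((Lc : ℝ) ^ (2 * (3 + 1))) cB Tc (hB_base (one_le_of_two_le hLc)) (hmix_an1 (one_le_of_two_le hLc) hr)) (hmix_an1 (one_le_of_two_le hLc) hr))) N μ ν ↔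
      B12Beta.secondMoment (hessKer (axDressK Lc (limMKerOf fun j => unitK (sfStep Lc j) (smStep 3 Lc j) (KInvStep (d := 3) Lc j)))
        (axVertexOfK (limMKerOf fun j => unitK (sfStep Lc j) (smStep 3 Lc j) (KInvStep (d := 3) Lc j)) Lc
          (limStOf fun j => unitS (sfStep Lc j) (smStep 3 Lc j) (JsBal0Of (one_le_of_two_le hLc) cE cVH cΛ (WbalOf 3 Lc cE cVH cΛ (T2Of 3 Lc cE cVH cΛ ((Lc : ℝ) ^ (2 * (3 + 1))) cB Tc (vh₂S 3 Lc) (mixFFAt (toSite r) Lc)) (mixFFAt (toSite r) Lc))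
            (CwOf (one_le_of_two_le hLc) cE cVH cΛ (T2Of_loc (one_le_of_two_le hLc) cE cVH cΛ ((Lc : ℝ) ^ (2 * (3 + 1))) cB Tc (hB_base (one_le_of_two_le hLc)) (hmix_an1 (one_le_of_two_le hLc) hr)) (hmix_an1 (one_le_of_two_le hLc) hr)) (δwOf (one_le_of_two_le hLc) cE cVH cΛ (T2Of_loc (one_le_of_two_le hLc) cE cVH cΛ ((Lc : ℝ) ^ (2 * (3 + 1))) cB Tc (hB_base (one_le_of_two_le hLc)) (hmix_an1 (one_le_of_two_le hLc) hr)) (hmix_an1 (one_le_of_two_le hLc) hr))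
        (δwOf_pos (one_le_of_two_le hLc) cE cVH cΛ (T2Of_loc (one_le_of_two_le hLc) cE cVH cΛ ((Lc : ℝ) ^ (2 * (3 + 1))) cB Tc (hB_base (one_le_of_two_le hLc)) (hmix_an1 (one_le_of_two_le hLc) hr)) (hmix_an1 (one_le_of_two_le hLc) hr)) (WbalOf_loc₂ (one_le_of_two_le hLc) cE cVH cΛ (T2Of_loc (one_le_of_two_le hLc) cE cVH cΛ ((Lc : ℝ) ^ (2 * (3 + 1))) cB Tc (hB_base (one_le_of_two_le hLc)) (hmix_an1 (one_le_of_two_le hLc) hr)) (hmix_an1 (one_le_of_two_le hLc) hr)) j).S))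
        (limTabOf fun j => unitW (sfStep Lc j) (smStep 3 Lc j) (WbalOf 3 Lc cE cVH cΛ (T2Of 3 Lc cE cVH cΛ ((Lc : ℝ) ^ (2 * (3 + 1))) cB Tc (vh₂S 3 Lc) (mixFFAt (toSite r) Lc)) (mixFFAt (toSite r) Lc) j))) μ ν = B12Normalization.stepBal N Lc := by
  obtain ⟨Cw, cW, θW, δW, hθW0, hθW1, hδW, hW₂, hW₂all⟩ := hW_hWall_three_an1_pinned hLc hr cE cVH cΛ cB Tc
  obtain ⟨cV, θ₁₁, ρ₁₁, -, hθ₁₁0, hθ₁₁1, hρ₁₁0, hρ₁₁1, dV⟩ := S3DiffV.diffV_three (Lc := Lc) hLc cVH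
  exact d1Drift_JsBalOf_iff_three_of_diffRows hLc cE cVH cΛ (TaylorRowDWThree.rowDW_three (Lc := Lc) hLc cE)
    ⟨cV, θ₁₁, ρ₁₁, hθ₁₁0, hθ₁₁1, hρ₁₁0, hρ₁₁1, dV⟩ (S3DiffL.diffL_three (Lc := Lc) hLc cΛ) _ _ _ _ _ hW₂ hW₂all hδW hθW0 hθW1 μ ν N

/-- **THE SAME CLOSING SENTENCE IN an2's PACKAGED NAME** `BalabanStepW2.JsBalT2Of` (the dressed jet-data family with recursive second-order tables,
`hT₂` discharged by `T2Of_loc`; here with the base border `hB_base` and an1's `hmix_an1`) AT `cE₂ := (Lc:ℝ)^(2*(3+1))`: the D1 wall ⟺ the identification,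
NO analytic hypothesis.  Definitionally the statement of `d1Drift_iff_three_an1_pinned` (`JsBalT2Of_eq`, `JsBalW2Of_apply` are `rfl`). -/
theorem d1Drift_iff_three_JsBalT2Of_pinned (hLc : 2 ≤ Lc) (hr : r ∈ box (3 + 1) Lc) (cE cVH cΛ cB : ℝ)
    (Tc : Fin 4 → Fin 4 → Fin 4 → Fin 4 → ℝ) (μ ν : Fin 4) (N : ℝ) :
    D1Drift Lc (JsBalT2Of (one_le_of_two_le hLc) cE cVH cΛ ((Lc : ℝ) ^ (2 * (3 + 1))) cB Tc
        (hB_base (one_le_of_two_le hLc)) (hmix_an1 (one_le_of_two_le hLc) hr)) N μ ν ↔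
      B12Beta.secondMoment (hessKer (axDressK Lc (limMKerOf fun j => unitK (sfStep Lc j) (smStep 3 Lc j) (KInvStep (d := 3) Lc j)))
        (axVertexOfK (limMKerOf fun j => unitK (sfStep Lc j) (smStep 3 Lc j) (KInvStep (d := 3) Lc j)) Lc
          (limStOf fun j => unitS (sfStep Lc j) (smStep 3 Lc j) (JsBal0Of (one_le_of_two_le hLc) cE cVH cΛ (WbalOf 3 Lc cE cVH cΛ (T2Of 3 Lc cE cVH cΛ ((Lc : ℝ) ^ (2 * (3 + 1))) cB Tc (vh₂S 3 Lc) (mixFFAt (toSite r) Lc)) (mixFFAt (toSite r) Lc))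
            (CwOf (one_le_of_two_le hLc) cE cVH cΛ (T2Of_loc (one_le_of_two_le hLc) cE cVH cΛ ((Lc : ℝ) ^ (2 * (3 + 1))) cB Tc (hB_base (one_le_of_two_le hLc)) (hmix_an1 (one_le_of_two_le hLc) hr)) (hmix_an1 (one_le_of_two_le hLc) hr)) (δwOf (one_le_of_two_le hLc) cE cVH cΛ (T2Of_loc (one_le_of_two_le hLc) cE cVH cΛ ((Lc : ℝ) ^ (2 * (3 + 1))) cB Tc (hB_base (one_le_of_two_le hLc)) (hmix_an1 (one_le_of_two_le hLc) hr)) (hmix_an1 (one_le_of_two_le hLc) hr))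
        (δwOf_pos (one_le_of_two_le hLc) cE cVH cΛ (T2Of_loc (one_le_of_two_le hLc) cE cVH cΛ ((Lc : ℝ) ^ (2 * (3 + 1))) cB Tc (hB_base (one_le_of_two_le hLc)) (hmix_an1 (one_le_of_two_le hLc) hr)) (hmix_an1 (one_le_of_two_le hLc) hr)) (WbalOf_loc₂ (one_le_of_two_le hLc) cE cVH cΛ (T2Of_loc (one_le_of_two_le hLc) cE cVH cΛ ((Lc : ℝ) ^ (2 * (3 + 1))) cB Tc (hB_base (one_le_of_two_le hLc)) (hmix_an1 (one_le_of_two_le hLc) hr)) (hmix_an1 (one_le_of_two_le hLc) hr)) j).S))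
        (limTabOf fun j => unitW (sfStep Lc j) (smStep 3 Lc j) (WbalOf 3 Lc cE cVH cΛ (T2Of 3 Lc cE cVH cΛ ((Lc : ℝ) ^ (2 * (3 + 1))) cB Tc (vh₂S 3 Lc) (mixFFAt (toSite r) Lc)) (mixFFAt (toSite r) Lc) j))) μ ν = B12Normalization.stepBal N Lc :=
  d1Drift_iff_three_an1_pinned hLc hr cE cVH cΛ cB Tc μ ν N

/-! ## §4 (v1.1, gen 6) END #3 RE-TYPED PER ref2 R55-2 (w10) ∕ R79-2 (w14): SEPARATE rate∕constant quadruples for the SHAPE tower and the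
DIFFERENCE tower, GENERIC second-order family `T₂` (any border table, any mixed table, any root — the top socket a rooted or re-pinned re-run feeds) -/

open Summit.QuantumFields.BalabanUV.Beta.GAN24.WSlotT2OfPieces (rate_of_rows cauchy_of_rate) in
/-- **END #3′ OF ROAD «W3», INSTANTIABLE FORM (`d = 3`, `Lc ≥ 2`)** — answers ref2's CONDITION (w10)∕(w14) on §1: the SHAPE tower (END #1,
`WSlotT2OfPieces.shape_of_rows`: transport `P`, sources `b`, predicates `Zfree`∕`mom`, rates `(δin, δT)`, constants `(CT, CT′, ρ, Cb, C₀)`) and the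
DIFFERENCE tower (END #2 generic, `WSlotT2OfPieces.rate_of_rows` ⨾ `cauchy_of_rate`: transport `P′`, forcing `f`, predicates `Zfree′`∕`mom′`, rates
`(δin′, δT′)`, constants `(CT″, ρ′, θ, Cf, D₀)`) carry THEIR OWN data — nothing is shared between the towers, so each row of record plugs in at its own
landed rate (F3a∕F3b at `δin` resp. `δin′`, F4b's existential forcing rate as `δin′`, …); the two outputs meet in leaf-07's wall socket
`WSlotCauchyThree.hW_hWall_three_of_T2ShapeDrift` at the common rate `min δT δT′` by `LocStencil₂.mono` (exactly R55-2's prescription).  The family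
`T₂` is GENERIC (no `T2Of`, no border `vh₂S`, no pin in the statement: the pin enters only through whichever transport row the instantiator supplies as
`hTmarg`), so this is also the END a border-rooted ((w9): `vh₂SAt ρ Lc`), fully rooted or recursive re-run of the rows would feed.  For the PINNED
base-border family the instantiated W-pair is §2 (via leaf-08's chain); §1 (shared rates) stays as the archival first cut.  [folklore] composition. -/
theorem wRows_three_of_rows₂ (hLc : 2 ≤ Lc) (cE cVH cΛ : ℝ)
    (T₂ : ℕ → Fin (3 + 1) → (Fin (3 + 1) → ℤ) → Fin (3 + 1) → (Fin (3 + 1) → ℤ) → MKer (3 + 1) (Fib 3))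
    (mixFF : Fin (3 + 1) → (Fin (3 + 1) → ℤ) → Fin (3 + 1) → (Fin (3 + 1) → ℤ) → MKer (3 + 1) (Fib 3))
    (b f : ℕ → Fin (3 + 1) → (Fin (3 + 1) → ℤ) → Fin (3 + 1) → (Fin (3 + 1) → ℤ) → MKer (3 + 1) (Fib 3))
    (P P' : ℕ → ℕ → (Fin (3 + 1) → (Fin (3 + 1) → ℤ) → Fin (3 + 1) → (Fin (3 + 1) → ℤ) → MKer (3 + 1) (Fib 3)) → Fin (3 + 1) → (Fin (3 + 1) → ℤ) → Fin (3 + 1) → (Fin (3 + 1) → ℤ) → MKer (3 + 1) (Fib 3))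
    (Zfree Zfree' : (Fin (3 + 1) → (Fin (3 + 1) → ℤ) → Fin (3 + 1) → (Fin (3 + 1) → ℤ) → MKer (3 + 1) (Fib 3)) → Prop)
    (mom mom' : (Fin (3 + 1) → (Fin (3 + 1) → ℤ) → Fin (3 + 1) → (Fin (3 + 1) → ℤ) → MKer (3 + 1) (Fib 3)) → ℝ)
    {δin δT CT CT' ρ Cb C₀ δin' δT' CT'' ρ' θ Cf D₀ : ℝ}
    (hδT : 0 < δT) (hCT' : 0 ≤ CT') (hρ0 : 0 ≤ ρ) (hρ1 : ρ < 1)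
    (hδT' : 0 < δT') (hCT'' : 0 ≤ CT'') (hρ'0 : 0 ≤ ρ') (hρ'1 : ρ' < 1) (hθ0 : 0 ≤ θ) (hθ1 : θ < 1)
    (hsplit : ∀ n, unitS₂ (sfStep Lc n) (smStep 3 Lc n) (T₂ n) =
      P 0 n (unitS₂ (sfStep Lc 0) (smStep 3 Lc 0) (T₂ 0)) + ∑ i ∈ Finset.range n, P (i + 1) (n - 1 - i) (b i))
    (hsplitD : ∀ n, (fun κ u κ' u' => unitS₂ (sfStep Lc (n + 1)) (smStep 3 Lc (n + 1)) (T₂ (n + 1)) κ u κ' u' - unitS₂ (sfStep Lc n) (smStep 3 Lc n) (T₂ n) κ u κ' u') =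
      P' 0 n (fun κ u κ' u' => unitS₂ (sfStep Lc 1) (smStep 3 Lc 1) (T₂ 1) κ u κ' u' - unitS₂ (sfStep Lc 0) (smStep 3 Lc 0) (T₂ 0) κ u κ' u')
        + ∑ i ∈ Finset.range n, P' (i + 1) (n - 1 - i) (f i))
    (hTmarg : ∀ (m k : ℕ) (X : Fin (3 + 1) → (Fin (3 + 1) → ℤ) → Fin (3 + 1) → (Fin (3 + 1) → ℤ) → MKer (3 + 1) (Fib 3)) (C : ℝ),
      0 ≤ C → LocStencil₂ X C δin → LocStencil₂ (P m k X) (CT * C) δT)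
    (hTirr : ∀ (m k : ℕ) (X : Fin (3 + 1) → (Fin (3 + 1) → ℤ) → Fin (3 + 1) → (Fin (3 + 1) → ℤ) → MKer (3 + 1) (Fib 3)) (C : ℝ),
      0 ≤ C → LocStencil₂ X C δin → Zfree X → mom X ≤ C → LocStencil₂ (P m k X) (CT' * C * ρ ^ k) δT)
    (hTirr' : ∀ (m k : ℕ) (X : Fin (3 + 1) → (Fin (3 + 1) → ℤ) → Fin (3 + 1) → (Fin (3 + 1) → ℤ) → MKer (3 + 1) (Fib 3)) (C : ℝ),
      0 ≤ C → LocStencil₂ X C δin' → Zfree' X → mom' X ≤ C → LocStencil₂ (P' m k X) (CT'' * C * ρ' ^ k) δT')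
    (hb : ∀ m, LocStencil₂ (b m) Cb δin ∧ mom (b m) ≤ Cb) (hZ : ∀ m, Zfree (b m))
    (hf : ∀ m, LocStencil₂ (f m) (Cf * θ ^ m) δin' ∧ mom' (f m) ≤ Cf * θ ^ m) (hZf : ∀ m, Zfree' (f m))
    (h0 : LocStencil₂ (unitS₂ (sfStep Lc 0) (smStep 3 Lc 0) (T₂ 0)) C₀ δin)
    (hD0 : LocStencil₂ (fun κ u κ' u' => unitS₂ (sfStep Lc 1) (smStep 3 Lc 1) (T₂ 1) κ u κ' u' - unitS₂ (sfStep Lc 0) (smStep 3 Lc 0) (T₂ 0) κ u κ' u') D₀ δin' ∧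
      mom' (fun κ u κ' u' => unitS₂ (sfStep Lc 1) (smStep 3 Lc 1) (T₂ 1) κ u κ' u' - unitS₂ (sfStep Lc 0) (smStep 3 Lc 0) (T₂ 0) κ u κ' u') ≤ D₀)
    (hZ0 : Zfree' (fun κ u κ' u' => unitS₂ (sfStep Lc 1) (smStep 3 Lc 1) (T₂ 1) κ u κ' u' - unitS₂ (sfStep Lc 0) (smStep 3 Lc 0) (T₂ 0) κ u κ' u'))
    {CM₂ δ₄ : ℝ} (hmix : LocStencilFM Lc mixFF CM₂ δ₄) (hδ₄ : 0 < δ₄)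
    (hfm : ∀ κ u ρ w x z (α μ' : Fin (3 + 1)), mixFF κ u ρ w x z (Sum.inl α) (Sum.inr μ') = 0)
    (hm : ∀ κ u ρ w x z (μ' : Fin (3 + 1)) (bb : Fib 3), mixFF κ u ρ w x z (Sum.inr μ') bb = 0) :
    ∃ Cw cW θW δW : ℝ, 0 ≤ θW ∧ θW < 1 ∧ 0 < δW ∧
      (∀ j, VertexFamily₂ (unitW (sfStep Lc j) (smStep 3 Lc j) (WbalOf 3 Lc cE cVH cΛ T₂ mixFF j)) Lc Cw δW) ∧
      (∀ k j, VertexFamily₂ (unitW (sfStep Lc (k + j)) (smStep 3 Lc (k + j)) (WbalOf 3 Lc cE cVH cΛ T₂ mixFF (k + j)) -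
        unitW (sfStep Lc k) (smStep 3 Lc k) (WbalOf 3 Lc cE cVH cΛ T₂ mixFF k)) Lc (cW * θW ^ k) δW) := by
  -- END #1 (shape tower) at its own output rate `δT`
  have hT₂' : ∀ j, LocStencil₂ (unitS₂ (sfStep Lc j) (smStep 3 Lc j) (T₂ j)) (CT * C₀ + CT' * Cb * (1 - ρ)⁻¹) δT :=
    shape_of_rows (fun n => unitS₂ (sfStep Lc n) (smStep 3 Lc n) (T₂ n)) b P Zfree mom hCT' hρ0 hρ1 hsplit hTmarg hTirr hb hZ h0
  -- END #2 (difference tower) at its own output rate `δT'`, then the Cauchy form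
  obtain ⟨c, ϑ, hc, hϑ0, hϑ1, hD⟩ := rate_of_rows
    (fun n => fun κ u κ' u' => unitS₂ (sfStep Lc (n + 1)) (smStep 3 Lc (n + 1)) (T₂ (n + 1)) κ u κ' u' - unitS₂ (sfStep Lc n) (smStep 3 Lc n) (T₂ n) κ u κ' u')
    f P' Zfree' mom' hCT'' hρ'0 hρ'1 hθ0 hθ1 hsplitD hTirr' hf hZf hD0 hZ0
  have hcau : ∀ k j, LocStencil₂ (fun κ u κ' u' => unitS₂ (sfStep Lc (k + j)) (smStep 3 Lc (k + j)) (T₂ (k + j)) κ u κ' u' -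
      unitS₂ (sfStep Lc k) (smStep 3 Lc k) (T₂ k) κ u κ' u') (c * (1 - ϑ)⁻¹ * ϑ ^ k) δT' :=
    fun k j => cauchy_of_rate (fun n => unitS₂ (sfStep Lc n) (smStep 3 Lc n) (T₂ n)) hc hϑ0.le hϑ1 hD k j
  -- both at the common rate `min δT δT'` into the wall socket
  exact hW_hWall_three_of_T2ShapeDrift hLc cE cVH cΛ (T₂ := T₂) (δ₂ := min δT δT')
    (fun j => (hT₂' j).mono (min_le_left _ _)) (fun k j => (hcau k j).mono (min_le_right _ _))
    (lt_min hδT hδT') hϑ0.le hϑ1 hmix hδ₄ hfm hm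

end Summit.QuantumFields.BalabanUV.Beta.GAN24.WSlotT2Tables

end
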